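import Summits.QuantumFields.BalabanUV.T4Continuum.Support.PerturbationAlgebra

/-!
# T⁴ programme, spine node NE2 (U1a) — THE ADJOINT FIRST-ORDER SHAPE `Σ_μ ∇_μᴴ·diag(W_μ)`: `PerturbationLaws` for the adjoints
# of the minimal-coupling family (needed for SELF-ADJOINT covariant Laplacians `Δ^U − Δ = F + Fᴴ + diag Z`)

Ninth generation of the NE2 prover lineage P1 of the cell `pub-balaban`, file 13 (on top of files 7–8).  A covariant Laplacian
perturbation is self-adjoint, `Δ^U − Δ = F + Fᴴ + (zeroth order)` with `F = Σ_μ diag(W_μ)∇_μ` (`FirstOrderBackgroundModel.firstOrder`).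
The typed inequalities `PerturbationLaws` are NOT symmetric under `P ↦ Pᴴ` ((H-cons) reads `P′J − JP` with the injection on fixed
sides), so the adjoint shape `Fᴴ = Σ_μ ∇_μᴴ diag(W̄_μ)` needs its own two-level analysis:

 * §1 per-direction bounds: `‖∇_μᴴ·diag(V)·𝒢‖ ≤ (α + β)Cst` (Leibniz + `∇ᴴ = −Sᴴ∇`), `‖𝒢·∇_μᴴ‖ ≤ Cst` ((1.89) `𝒢∇*` item);
 * §2 the intertwiners of the BACKWARD difference: `shiftM_mul_conjTranspose` (`SSᴴ = 1`), **`JKH_fdiff_JK`** `Jᴴ∇′J = ∇` (from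
   `∇′J = R·FJ∇` and `JᴴFJ = R⁻¹`), **`conjTranspose_fdiff_mul_JK`** `∇′ᴴJ = R·S′ᴴ·F·J·S·∇ᴴ`, and
   **`Pi_mul_adjoint_defect`** `Π(∇′ᴴJ − J∇ᴴ) = 0`;
 * §3 **`adjoint_consistency_decomp`**: `∇′ᴴD′J − J∇ᴴD = ∇′ᴴ(D′ − D̄)J + (1 − Π)(∇′ᴴJ − J∇ᴴ)D` and **`opNorm_adjoint_consistency_le`**:
   `‖𝒢′((F′)ᴴJ − JFᴴ)𝒢‖ ≤ d·Cst²(δ + 2η·d(R + 1)(α + β))`;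
 * §4 **`perturbationLaws_firstOrderAdjoint`**: for every `LipschitzBackground V α β`, the family `k ↦ (Pmodel V k)ᴴ` satisfies
   `PerturbationLaws` with `κ = d(α + β)Cst` and `e₂ k = C₂ᴴ·L^{−k}`, `C₂ᴴ = d·Cst²(β + 2d(L + 1)(α + β))`.

HONEST FRAMING (T4-DAG p. 1).  Model-level (abelian-type coefficient fields, global small gauge); finite torus, linear layer,
operator norm; rates / constants OURS; nothing printed is a hypothesis; NOT infinite volume / mass gap / Clay / summit progress; spine
0/9 unchanged.  HONEST DEPENDENCY: continuum YM on T⁴ ⇐ BetaPertH ∧ nine spine estimates (0/9 proved); BetaPertH ⇐ (D1) ∧ (D4) ∧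
CAP+tail; G-an2-4 gates asym, D1 and NE2/3/4.  ABSOLUTE RULE kept; no `sorry`.
-/

noncomputable section

open scoped BigOperators ComplexConjugate Matrix Matrix.Norms.L2Operator
open Filter Topology

namespace Summit.QuantumFields.BalabanUV.T4Continuum.FirstOrderAdjointModel

open Literature.MathematicalPhysics.QuantumFieldTheory.Balaban1983to89.B5Prop11Plancherel
open Literature.MathematicalPhysics.QuantumFieldTheory.Balaban1983to89.B5G183RateTorusW
open Literature.MathematicalPhysics.QuantumFieldTheory.Balaban1983to89.B5G183RateUnitTower (lev lev_neZero)
open Summit.QuantumFields.BalabanUV.T4Continuum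
open Summit.QuantumFields.BalabanUV.T4Continuum.CovariantAveragingTower (TowerLimitRate)
open Summit.QuantumFields.BalabanUV.T4Continuum.BalabanAveragedTowerUnit (idx Qlev calGlev one_le_lev' cast_lev')
open Summit.QuantumFields.BalabanUV.T4Continuum.BalabanBlockPoincare (Pi transl transl_eq_iff shiftM_eq_transl)
open Summit.QuantumFields.BalabanUV.T4Continuum.NE2PerturbedLayer
open Summit.QuantumFields.BalabanUV.T4Continuum.BackgroundResolventTower
open Summit.QuantumFields.BalabanUV.T4Continuum.KingPairingPlantedLaw
open Summit.QuantumFields.BalabanUV.T4Continuum.BlockPairingGeometry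
open Summit.QuantumFields.BalabanUV.T4Continuum.BlockPairingFaces
open Summit.QuantumFields.BalabanUV.T4Continuum.FirstOrderBackgroundModel
open Summit.QuantumFields.BalabanUV.T4Continuum.PerturbationAlgebra

variable {d : ℕ}

/-! ## §1 Per-direction bounds -/

section Level

variable (n : ℕ) [NeZero n] (hn : 1 ≤ n) (M : Fin d → ℕ) [hM : ∀ μ, NeZero (M μ)] (a : ℝ) (ha : 0 < a)

/-- `∇ᴴ = −Sᴴ∇` for the natural lattice factor. [folklore] -/
theorem conjTranspose_fdiff_eq (μ : Fin d) :
    (fdiff (fine n M) ((n : ℕ) : ℂ) μ)ᴴ = -((shiftM (fine n M) μ)ᴴ * fdiff (fine n M) ((n : ℕ) : ℂ) μ) := by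
  have e : ((n : ℕ) : ℂ) = ((n : ℝ) : ℂ) := by push_cast; rfl
  have h1 := congrArg Matrix.conjTranspose (fdiff_eq_neg_conjTranspose_mul (fine n M) (n : ℝ) μ)
  rw [Matrix.conjTranspose_neg, Matrix.conjTranspose_mul, Matrix.conjTranspose_conjTranspose] at h1
  rw [e]; exact h1

/-- **`‖∇_μᴴ·diag(V)·𝒢‖ ≤ (α + β)·Cst`** for `|V| ≤ α` and `|V(x + e_μ) − V(x)| ≤ β/n` (Leibniz, `∇ᴴ = −Sᴴ∇`, (1.89)).
[cite: Balaban1984PropagatorsI, Prop. 1.1 (1.89) p.33, (1.31) p.23] [folklore] -/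
theorem opNorm_fdiffH_diag_calG_le (μ : Fin d) {V : Tor (fine n M) × Fin d → ℂ} {α β : ℝ} (hα : 0 ≤ α) (hβ : 0 ≤ β)
    (hV : ∀ i, ‖V i‖ ≤ α) (hLip : ∀ i, ‖V (tau (fine n M) μ i) - V i‖ ≤ β / n) :
    ‖(fdiff (fine n M) ((n : ℕ) : ℂ) μ)ᴴ * Matrix.diagonal V * calG n hn M a ha‖ ≤ (α + β) * Cst d a := by
  have hnpos : (0 : ℝ) < n := by exact_mod_cast hn
  have hC := Cst_nonneg d a
  set G := calG n hn M a ha with hG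
  have hform : (shiftM (fine n M) μ)ᴴ * fdiff (fine n M) ((n : ℕ) : ℂ) μ * Matrix.diagonal V * G
      = (shiftM (fine n M) μ)ᴴ * (Matrix.diagonal (V ∘ tau (fine n M) μ) * (fdiff (fine n M) ((n : ℕ) : ℂ) μ * G)
          + ((n : ℕ) : ℂ) • (Matrix.diagonal (V ∘ tau (fine n M) μ) * G - Matrix.diagonal V * G)) := by
    rw [Matrix.mul_assoc ((shiftM (fine n M) μ)ᴴ) (fdiff (fine n M) ((n : ℕ) : ℂ) μ) (Matrix.diagonal V),
      fdiff_mul_diagonal, Matrix.mul_assoc, Matrix.add_mul, Matrix.smul_mul, Matrix.sub_mul, Matrix.mul_assoc]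
  rw [conjTranspose_fdiff_eq, Matrix.neg_mul, Matrix.neg_mul, norm_neg, hform]
  have hS : ‖(shiftM (fine n M) μ)ᴴ‖ ≤ 1 := by rw [Matrix.l2_opNorm_conjTranspose]; exact opNorm_shiftM_le _ μ
  have hVt : ∀ i, ‖(V ∘ tau (fine n M) μ) i‖ ≤ α := fun i => hV _
  have hp1 : ‖Matrix.diagonal (V ∘ tau (fine n M) μ) * (fdiff (fine n M) ((n : ℕ) : ℂ) μ * G)‖ ≤ α * Cst d a :=
    (Matrix.l2_opNorm_mul _ _).trans (mul_le_mul (opNorm_diagonal_le _ hα hVt) (opNorm_fdiff_calG_le n hn M a ha μ)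
      (norm_nonneg _) hα)
  have hdiff : ‖Matrix.diagonal (V ∘ tau (fine n M) μ) * G - Matrix.diagonal V * G‖ ≤ β / n * Cst d a := by
    rw [← Matrix.sub_mul, Matrix.diagonal_sub]
    refine (Matrix.l2_opNorm_mul _ _).trans (mul_le_mul ?_ (opNorm_calG_le n hn M a ha) (norm_nonneg _) (by positivity))
    exact opNorm_diagonal_le _ (by positivity) fun i => hLip i
  have hp2 : ‖((n : ℕ) : ℂ) • (Matrix.diagonal (V ∘ tau (fine n M) μ) * G - Matrix.diagonal V * G)‖ ≤ β * Cst d a := by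
    rw [norm_smul, Complex.norm_natCast]
    calc (n : ℝ) * ‖Matrix.diagonal (V ∘ tau (fine n M) μ) * G - Matrix.diagonal V * G‖
        ≤ n * (β / n * Cst d a) := mul_le_mul_of_nonneg_left hdiff hnpos.le
      _ = β * Cst d a := by field_simp
  calc _ ≤ ‖(shiftM (fine n M) μ)ᴴ‖ * ‖Matrix.diagonal (V ∘ tau (fine n M) μ) * (fdiff (fine n M) ((n : ℕ) : ℂ) μ * G)
          + ((n : ℕ) : ℂ) • (Matrix.diagonal (V ∘ tau (fine n M) μ) * G - Matrix.diagonal V * G)‖ := Matrix.l2_opNorm_mul _ _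
    _ ≤ 1 * (α * Cst d a + β * Cst d a) := mul_le_mul hS ((norm_add_le _ _).trans (add_le_add hp1 hp2)) (norm_nonneg _) zero_le_one
    _ = (α + β) * Cst d a := by ring

/-- `‖𝒢·∇_μᴴ‖ ≤ Cst` — the printed (1.89) item `𝒢∇*` in the tree (`star = ᴴ`). [cite: Balaban1984PropagatorsI, Prop. 1.1 (1.89) p.33] -/
theorem opNorm_calG_mul_fdiffH_le (μ : Fin d) : ‖calG n hn M a ha * (fdiff (fine n M) ((n : ℕ) : ℂ) μ)ᴴ‖ ≤ Cst d a := by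
  have h := opNorm_calG_star_fdiff_le n hn M a ha μ
  rwa [Matrix.star_eq_conjTranspose] at h

end Level

/-! ## §2 The intertwiners of the backward difference -/

/-- `(Σ_μ diag(W_μ)·∇_μ)ᴴ = Σ_μ ∇_μᴴ·diag(W̄_μ)`. [folklore] -/
theorem conjTranspose_firstOrder (Nf : Fin d → ℕ) [∀ μ, NeZero (Nf μ)] (c : ℂ) (W : Fin d → (Tor Nf × Fin d → ℂ)) :
    (firstOrder Nf c W)ᴴ = ∑ μ, (fdiff Nf c μ)ᴴ * Matrix.diagonal (star (W μ)) := by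
  rw [firstOrder, Matrix.conjTranspose_sum]
  refine Finset.sum_congr rfl fun μ _ => ?_
  rw [Matrix.conjTranspose_mul, Matrix.diagonal_conjTranspose]

section TwoLevel

variable (N R : ℕ) [NeZero N] [NeZero R] (M : Fin d → ℕ) [hM : ∀ μ, NeZero (M μ)]

/-- `S_μ S_μᴴ = 1`. [folklore] -/
theorem shiftM_mul_conjTranspose (Nf : Fin d → ℕ) [∀ μ, NeZero (Nf μ)] (μ : Fin d) : shiftM Nf μ * (shiftM Nf μ)ᴴ = 1 := by
  rw [shiftM_eq_transl, conjTranspose_transl, ← BalabanBlockPoincare.transl_add, add_neg_cancel, BalabanBlockPoincare.transl_zero]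

/-- **`Jᴴ∇′J = ∇`**: the compression of the fine difference to block constants is the coarse difference. [cite: King1986, (2.10)
p.653] [folklore] -/
theorem JKH_fdiff_JK (hd : 1 ≤ d) (hN : 1 ≤ N) (μ : Fin d) :
    (JK N R M)ᴴ * fdiff (fine (R * N) M) (((R * N : ℕ)) : ℂ) μ * JK N R M = fdiff (fine N M) ((N : ℕ) : ℂ) μ := by
  have hRc : (R : ℂ) ≠ 0 := by exact_mod_cast NeZero.ne R
  rw [Matrix.mul_assoc, fdiff_mul_JK N R M hN μ, Matrix.mul_smul, ← Matrix.mul_assoc, ← Matrix.mul_assoc,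
    JKH_mul_faceF_mul_JK N R M hd μ, Matrix.smul_mul, Matrix.one_mul, smul_smul, mul_inv_cancel₀ hRc, one_smul]

/-- **`∇′ᴴJ = R·S′ᴴ·F·J·S·∇ᴴ`** (backward companion of `∇′J = R·FJ∇`: `∇′ᴴ = −S′ᴴ∇′`, `∇ = −S∇ᴴ`). [folklore] -/
theorem conjTranspose_fdiff_mul_JK (hN : 1 ≤ N) (μ : Fin d) :
    (fdiff (fine (R * N) M) (((R * N : ℕ)) : ℂ) μ)ᴴ * JK N R M
      = ((R : ℂ)) • ((shiftM (fine (R * N) M) μ)ᴴ * faceF N R M μ * JK N R M * shiftM (fine N M) μ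
          * (fdiff (fine N M) ((N : ℕ) : ℂ) μ)ᴴ) := by
  have hfine := conjTranspose_fdiff_eq (R * N) M μ
  have hcoarse : fdiff (fine N M) ((N : ℕ) : ℂ) μ = -(shiftM (fine N M) μ * (fdiff (fine N M) ((N : ℕ) : ℂ) μ)ᴴ) := by
    rw [conjTranspose_fdiff_eq N M μ, Matrix.mul_neg, ← Matrix.mul_assoc, shiftM_mul_conjTranspose, Matrix.one_mul, neg_neg]
  rw [hfine, Matrix.neg_mul, Matrix.mul_assoc, fdiff_mul_JK N R M hN μ, Matrix.mul_smul]
  conv_lhs => rw [hcoarse]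
  simp only [Matrix.mul_neg, smul_neg, neg_neg, Matrix.mul_assoc]

/-- **`Π·(∇′ᴴJ − J∇ᴴ) = 0`**: the backward-difference defect of a planted field has no block-constant component
(`Jᴴ∇′ᴴJ = (Jᴴ∇′J)ᴴ = ∇ᴴ`, `JᴴJ = 1`). [folklore] -/
theorem Pi_mul_adjoint_defect (hd : 1 ≤ d) (hN : 1 ≤ N) (μ : Fin d) :
    Pi N R M * ((fdiff (fine (R * N) M) (((R * N : ℕ)) : ℂ) μ)ᴴ * JK N R M - JK N R M * (fdiff (fine N M) ((N : ℕ) : ℂ) μ)ᴴ) = 0 := by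
  have h1 : (JK N R M)ᴴ * ((fdiff (fine (R * N) M) (((R * N : ℕ)) : ℂ) μ)ᴴ * JK N R M) = (fdiff (fine N M) ((N : ℕ) : ℂ) μ)ᴴ := by
    have h := congrArg Matrix.conjTranspose (JKH_fdiff_JK N R M hd hN μ)
    rw [Matrix.conjTranspose_mul, Matrix.conjTranspose_mul, Matrix.conjTranspose_conjTranspose] at h
    exact h
  rw [← JK_mul_conjTranspose, Matrix.mul_assoc, Matrix.mul_sub, h1, ← Matrix.mul_assoc (JK N R M)ᴴ (JK N R M),
    JK_conjTranspose_mul_JK, Matrix.one_mul, sub_self, Matrix.mul_zero]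

/-! ## §3 The adjoint two-level decomposition and its bound -/

/-- **THE EXACT DECOMPOSITION** (adjoint shape): `∇′ᴴ·D′·J − J·∇ᴴ·D = ∇′ᴴ·(D′ − D̄)·J + (1 − Π)·((∇′ᴴJ − J∇ᴴ)·D)`,
`D̄ = diag(W ∘ parT)`. [folklore] -/
theorem adjoint_consistency_decomp (hd : 1 ≤ d) (hN : 1 ≤ N) (μ : Fin d) (W' : Tor (fine (R * N) M) × Fin d → ℂ)
    (W : Tor (fine N M) × Fin d → ℂ) :
    (fdiff (fine (R * N) M) (((R * N : ℕ)) : ℂ) μ)ᴴ * Matrix.diagonal W' * JK N R M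
        - JK N R M * ((fdiff (fine N M) ((N : ℕ) : ℂ) μ)ᴴ * Matrix.diagonal W)
      = (fdiff (fine (R * N) M) (((R * N : ℕ)) : ℂ) μ)ᴴ * (Matrix.diagonal W' - Matrix.diagonal (W ∘ parT N R M)) * JK N R M
        + (1 - Pi N R M) * (((fdiff (fine (R * N) M) (((R * N : ℕ)) : ℂ) μ)ᴴ * JK N R M
            - JK N R M * (fdiff (fine N M) ((N : ℕ) : ℂ) μ)ᴴ) * Matrix.diagonal W) := by
  have hJD : JK N R M * Matrix.diagonal W = Matrix.diagonal (W ∘ parT N R M) * JK N R M := JK_mul_diagonal N R M W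
  have h4 : (1 - Pi N R M) * (((fdiff (fine (R * N) M) (((R * N : ℕ)) : ℂ) μ)ᴴ * JK N R M
        - JK N R M * (fdiff (fine N M) ((N : ℕ) : ℂ) μ)ᴴ) * Matrix.diagonal W)
      = ((fdiff (fine (R * N) M) (((R * N : ℕ)) : ℂ) μ)ᴴ * JK N R M - JK N R M * (fdiff (fine N M) ((N : ℕ) : ℂ) μ)ᴴ)
        * Matrix.diagonal W := by
    rw [Matrix.sub_mul, Matrix.one_mul, ← Matrix.mul_assoc, Pi_mul_adjoint_defect N R M hd hN μ, Matrix.zero_mul, sub_zero]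
  rw [h4, Matrix.mul_sub, Matrix.sub_mul, Matrix.sub_mul,
    Matrix.mul_assoc _ (Matrix.diagonal (W ∘ parT N R M)) (JK N R M), ← hJD]
  simp only [Matrix.mul_assoc]
  abel

variable (a : ℝ) (ha : 0 < a)

/-- **(H-cons) PER DIRECTION, adjoint shape**: `‖𝒢′(∇′ᴴD′J − J∇ᴴD)𝒢‖ ≤ Cst·δ·Cst + (2dCst·η)(R + 1)(α + β)Cst`. [cite:
Balaban1984PropagatorsI, Prop. 1.1 (1.89) p.33; King1986, (2.10) p.653] [folklore] -/
theorem opNorm_adjoint_consistency_dir_le (hd : 1 ≤ d) (hN : 1 ≤ N) (hRN : 1 ≤ R * N) (μ : Fin d)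
    {W' : Tor (fine (R * N) M) × Fin d → ℂ} {W : Tor (fine N M) × Fin d → ℂ} {α β δ : ℝ} (hα : 0 ≤ α) (hβ : 0 ≤ β) (hδ : 0 ≤ δ)
    (hW : ∀ i, ‖W i‖ ≤ α) (hLip : ∀ i, ‖W (tau (fine N M) μ i) - W i‖ ≤ β / N) (hcons : ∀ i, ‖W' i - W (parT N R M i)‖ ≤ δ) :
    ‖calG (R * N) hRN M a ha * ((fdiff (fine (R * N) M) (((R * N : ℕ)) : ℂ) μ)ᴴ * Matrix.diagonal W' * JK N R M
        - JK N R M * ((fdiff (fine N M) ((N : ℕ) : ℂ) μ)ᴴ * Matrix.diagonal W)) * calG N hN M a ha‖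
      ≤ Cst d a * δ * Cst d a + (2 * d * Cst d a / N) * (R + 1) * ((α + β) * Cst d a) := by
  have hC := Cst_nonneg d a
  have hNpos : (0 : ℝ) < N := by exact_mod_cast hN
  set G' := calG (R * N) hRN M a ha with hG'
  set G := calG N hN M a ha with hG
  rw [adjoint_consistency_decomp N R M hd hN μ W' W, Matrix.mul_add, Matrix.add_mul]
  refine (norm_add_le _ _).trans (add_le_add ?_ ?_)
  · -- `G' ∇′ᴴ (D′ − D̄) J G`
    have hD : ‖Matrix.diagonal W' - Matrix.diagonal (W ∘ parT N R M)‖ ≤ δ := by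
      rw [Matrix.diagonal_sub]; exact opNorm_diagonal_le _ hδ fun i => hcons i
    have e : G' * ((fdiff (fine (R * N) M) (((R * N : ℕ)) : ℂ) μ)ᴴ * (Matrix.diagonal W' - Matrix.diagonal (W ∘ parT N R M))
          * JK N R M) * G
        = (G' * (fdiff (fine (R * N) M) (((R * N : ℕ)) : ℂ) μ)ᴴ) * (Matrix.diagonal W' - Matrix.diagonal (W ∘ parT N R M))
          * (JK N R M * G) := by simp only [Matrix.mul_assoc]
    rw [e]
    have hA := opNorm_calG_mul_fdiffH_le (R * N) hRN M a ha μ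
    have hB : ‖JK N R M * G‖ ≤ Cst d a :=
      (Matrix.l2_opNorm_mul _ _).trans ((mul_le_mul (opNorm_JK_le N R M) (opNorm_calG_le N hN M a ha) (norm_nonneg _)
        zero_le_one).trans (le_of_eq (one_mul _)))
    calc _ ≤ ‖G' * (fdiff (fine (R * N) M) (((R * N : ℕ)) : ℂ) μ)ᴴ * (Matrix.diagonal W' - Matrix.diagonal (W ∘ parT N R M))‖
            * ‖JK N R M * G‖ := Matrix.l2_opNorm_mul _ _
      _ ≤ (Cst d a * δ) * Cst d a :=
          mul_le_mul ((Matrix.l2_opNorm_mul _ _).trans (mul_le_mul hA hD (norm_nonneg _) hC)) hB (norm_nonneg _) (by positivity)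
  · -- `G' (1 − Π) (∇′ᴴJ − J∇ᴴ) D G`
    have hPiG := opNorm_calG_mul_one_sub_Pi_le N R M a ha hN hRN
    have hX : ‖(fdiff (fine N M) ((N : ℕ) : ℂ) μ)ᴴ * Matrix.diagonal W * G‖ ≤ (α + β) * Cst d a :=
      opNorm_fdiffH_diag_calG_le N hN M a ha μ hα hβ hW hLip
    -- the defect applied to `D G`
    have e : G' * ((1 - Pi N R M) * (((fdiff (fine (R * N) M) (((R * N : ℕ)) : ℂ) μ)ᴴ * JK N R M
          - JK N R M * (fdiff (fine N M) ((N : ℕ) : ℂ) μ)ᴴ) * Matrix.diagonal W)) * G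
        = (G' * (1 - JK N R M * (JK N R M)ᴴ))
          * ((fdiff (fine (R * N) M) (((R * N : ℕ)) : ℂ) μ)ᴴ * JK N R M * (Matrix.diagonal W * G)
            - JK N R M * ((fdiff (fine N M) ((N : ℕ) : ℂ) μ)ᴴ * Matrix.diagonal W * G)) := by
      rw [JK_mul_conjTranspose]; simp only [Matrix.mul_assoc, Matrix.sub_mul, Matrix.mul_sub]
    rw [e]
    have hT1 : ‖(fdiff (fine (R * N) M) (((R * N : ℕ)) : ℂ) μ)ᴴ * JK N R M * (Matrix.diagonal W * G)‖ ≤ R * ((α + β) * Cst d a) := by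
      rw [conjTranspose_fdiff_mul_JK N R M hN μ, Matrix.smul_mul, norm_smul, Complex.norm_natCast]
      refine mul_le_mul_of_nonneg_left ?_ (Nat.cast_nonneg R)
      have e2 : (shiftM (fine (R * N) M) μ)ᴴ * faceF N R M μ * JK N R M * shiftM (fine N M) μ
            * (fdiff (fine N M) ((N : ℕ) : ℂ) μ)ᴴ * (Matrix.diagonal W * G)
          = ((shiftM (fine (R * N) M) μ)ᴴ * (faceF N R M μ * JK N R M) * shiftM (fine N M) μ)
            * ((fdiff (fine N M) ((N : ℕ) : ℂ) μ)ᴴ * Matrix.diagonal W * G) := by simp only [Matrix.mul_assoc]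
      rw [e2]
      have hU : ‖(shiftM (fine (R * N) M) μ)ᴴ * (faceF N R M μ * JK N R M) * shiftM (fine N M) μ‖ ≤ 1 := by
        have h1 : ‖(shiftM (fine (R * N) M) μ)ᴴ‖ ≤ 1 := by rw [Matrix.l2_opNorm_conjTranspose]; exact opNorm_shiftM_le _ μ
        have h2 : ‖faceF N R M μ * JK N R M‖ ≤ 1 :=
          (Matrix.l2_opNorm_mul _ _).trans ((mul_le_mul (opNorm_faceF_le N R M μ) (opNorm_JK_le N R M) (norm_nonneg _)
            zero_le_one).trans (le_of_eq (one_mul 1)))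
        have h3 := opNorm_shiftM_le (fine N M) μ
        calc _ ≤ ‖(shiftM (fine (R * N) M) μ)ᴴ * (faceF N R M μ * JK N R M)‖ * ‖shiftM (fine N M) μ‖ := Matrix.l2_opNorm_mul _ _
          _ ≤ (1 * 1) * 1 := mul_le_mul ((Matrix.l2_opNorm_mul _ _).trans (mul_le_mul h1 h2 (norm_nonneg _) zero_le_one)) h3
              (norm_nonneg _) (by norm_num)
          _ = 1 := by norm_num
      calc _ ≤ ‖(shiftM (fine (R * N) M) μ)ᴴ * (faceF N R M μ * JK N R M) * shiftM (fine N M) μ‖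
              * ‖(fdiff (fine N M) ((N : ℕ) : ℂ) μ)ᴴ * Matrix.diagonal W * G‖ := Matrix.l2_opNorm_mul _ _
        _ ≤ 1 * ((α + β) * Cst d a) := mul_le_mul hU hX (norm_nonneg _) zero_le_one
        _ = (α + β) * Cst d a := one_mul _
    have hT2 : ‖JK N R M * ((fdiff (fine N M) ((N : ℕ) : ℂ) μ)ᴴ * Matrix.diagonal W * G)‖ ≤ (α + β) * Cst d a :=
      (Matrix.l2_opNorm_mul _ _).trans ((mul_le_mul (opNorm_JK_le N R M) hX (norm_nonneg _) zero_le_one).trans (le_of_eq (one_mul _)))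
    have hαβ : 0 ≤ (α + β) * Cst d a := by positivity
    calc _ ≤ ‖G' * (1 - JK N R M * (JK N R M)ᴴ)‖
            * ‖(fdiff (fine (R * N) M) (((R * N : ℕ)) : ℂ) μ)ᴴ * JK N R M * (Matrix.diagonal W * G)
              - JK N R M * ((fdiff (fine N M) ((N : ℕ) : ℂ) μ)ᴴ * Matrix.diagonal W * G)‖ := Matrix.l2_opNorm_mul _ _
      _ ≤ (2 * d * Cst d a / N) * (R * ((α + β) * Cst d a) + (α + β) * Cst d a) :=
          mul_le_mul hPiG ((norm_sub_le _ _).trans (add_le_add hT1 hT2)) (norm_nonneg _) (by positivity)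
      _ = (2 * d * Cst d a / N) * (R + 1) * ((α + β) * Cst d a) := by ring

/-- **(H-cons), adjoint shape, summed over directions**: `‖𝒢′((F′)ᴴJ − JFᴴ)𝒢‖ ≤ d·(Cst·δ·Cst + (2dCst·η)(R + 1)(α + β)Cst)` for
`F = Σ_μ diag(W_μ)∇_μ`. [folklore] -/
theorem opNorm_adjoint_consistency_le (hd : 1 ≤ d) (hN : 1 ≤ N) (hRN : 1 ≤ R * N)
    {W' : Fin d → (Tor (fine (R * N) M) × Fin d → ℂ)} {W : Fin d → (Tor (fine N M) × Fin d → ℂ)} {α β δ : ℝ} (hα : 0 ≤ α)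
    (hβ : 0 ≤ β) (hδ : 0 ≤ δ) (hW : ∀ μ i, ‖W μ i‖ ≤ α) (hLip : ∀ μ i, ‖W μ (tau (fine N M) μ i) - W μ i‖ ≤ β / N)
    (hcons : ∀ μ i, ‖W' μ i - W μ (parT N R M i)‖ ≤ δ) :
    ‖calG (R * N) hRN M a ha * ((firstOrder (fine (R * N) M) (((R * N : ℕ)) : ℂ) W')ᴴ * JK N R M
        - JK N R M * (firstOrder (fine N M) ((N : ℕ) : ℂ) W)ᴴ) * calG N hN M a ha‖
      ≤ d * (Cst d a * δ * Cst d a + (2 * d * Cst d a / N) * (R + 1) * ((α + β) * Cst d a)) := by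
  rw [conjTranspose_firstOrder, conjTranspose_firstOrder, Matrix.sum_mul, Matrix.mul_sum, ← Finset.sum_sub_distrib,
    Matrix.mul_sum, Matrix.sum_mul]
  refine (norm_sum_le _ _).trans ?_
  have hterm : ∀ μ ∈ Finset.univ,
      ‖calG (R * N) hRN M a ha * ((fdiff (fine (R * N) M) (((R * N : ℕ)) : ℂ) μ)ᴴ * Matrix.diagonal (star (W' μ)) * JK N R M
          - JK N R M * ((fdiff (fine N M) ((N : ℕ) : ℂ) μ)ᴴ * Matrix.diagonal (star (W μ)))) * calG N hN M a ha‖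
        ≤ Cst d a * δ * Cst d a + (2 * d * Cst d a / N) * (R + 1) * ((α + β) * Cst d a) := by
    intro μ _
    refine opNorm_adjoint_consistency_dir_le N R M a ha hd hN hRN μ hα hβ hδ (fun i => ?_) (fun i => ?_) (fun i => ?_)
    · rw [Pi.star_apply, norm_star]; exact hW μ i
    · simp only [Pi.star_apply]; rw [← star_sub, norm_star]; exact hLip μ i
    · simp only [Pi.star_apply]; rw [← star_sub, norm_star]; exact hcons μ i
  refine (Finset.sum_le_sum hterm).trans (le_of_eq ?_)
  rw [Finset.sum_const, Finset.card_univ, Fintype.card_fin, nsmul_eq_mul]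

end TwoLevel

/-! ## §4 `PerturbationLaws` for the adjoint family and for the self-adjoint first-order coupling `F + Fᴴ` -/

section Tower

variable (L : ℕ) [NeZero L] (M : Fin d → ℕ) [hM : ∀ μ, NeZero (M μ)] (a : ℝ) (ha : 0 < a)

/-- the (H-cons) constant of the adjoint family: `C₂ᴴ = d·Cst²·(β + 2d(L + 1)(α + β))`. [folklore] -/
def C2adj (d L : ℕ) (a α β : ℝ) : ℝ := d * (Cst d a * β * Cst d a + 2 * d * Cst d a * ((L : ℝ) + 1) * ((α + β) * Cst d a))

/-- `C₂ᴴ ≥ 0`. [folklore] -/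
theorem C2adj_nonneg (d L : ℕ) (a : ℝ) {α β : ℝ} (hα : 0 ≤ α) (hβ : 0 ≤ β) : 0 ≤ C2adj d L a α β := by
  have := Cst_nonneg d a; unfold C2adj; positivity

/-- `𝒢` is Hermitian along the tower. [cite: Balaban1984PropagatorsI, (1.69) p.29] -/
theorem conjTranspose_inv_calDalev (k : ℕ) : ((calDalev L M a ha k)⁻¹)ᴴ = (calDalev L M a ha k)⁻¹ := by
  rw [calDalev_inv]; exact (calG_isHermitian _ _ M a ha).eq

/-- **`PerturbationLaws` FOR THE ADJOINT FAMILY `k ↦ (Σ_μ diag(V^{(k)}_μ)∇^{(k)}_μ)ᴴ`** (`d ≥ 1`): `κ = d(α + β)Cst`,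
`e₂ k = C₂ᴴ·L^{−k}`.  (H-bd) by adjoint symmetry from file 7; (H-cons) by the backward-difference decomposition of §3.
[cite: Balaban1984PropagatorsI, Prop. 1.1 (1.89) p.33; King1986, (2.10) p.653] [folklore] -/
theorem perturbationLaws_firstOrderAdjoint (hd : 1 ≤ d) {V : (k : ℕ) → Fin d → (idx L M k → ℂ)} {α β : ℝ}
    (hV : LipschitzBackground L M V α β) :
    PerturbationLaws (calDalev L M a ha) (fun k => (Pmodel L M V k)ᴴ) (JpcT L M) (d * (α + β) * Cst d a)
      (fun k => C2adj d L a α β * ((L : ℝ)⁻¹) ^ k) where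
  opNorm_P_mul_inv_le := fun k => by
    have e : (Pmodel L M V k)ᴴ * (calDalev L M a ha k)⁻¹ = ((calDalev L M a ha k)⁻¹ * Pmodel L M V k)ᴴ := by
      rw [Matrix.conjTranspose_mul, conjTranspose_inv_calDalev]
    rw [e, Matrix.l2_opNorm_conjTranspose]
    exact (perturbationLaws_firstOrder L M a ha hd hV).opNorm_inv_mul_P_le k
  opNorm_inv_mul_P_le := fun k => by
    have e : (calDalev L M a ha k)⁻¹ * (Pmodel L M V k)ᴴ = (Pmodel L M V k * (calDalev L M a ha k)⁻¹)ᴴ := by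
      rw [Matrix.conjTranspose_mul, conjTranspose_inv_calDalev]
    rw [e, Matrix.l2_opNorm_conjTranspose]
    exact (perturbationLaws_firstOrder L M a ha hd hV).opNorm_P_mul_inv_le k
  consistent_le := fun k => by
    have hL1 : 1 ≤ L := Nat.pos_of_ne_zero (NeZero.ne L)
    have hLpos : (0 : ℝ) < L := by exact_mod_cast hL1
    have hlev : (0 : ℝ) < (lev L k : ℕ) := by exact_mod_cast one_le_lev' L k
    change ‖(calDalev L M a ha (k + 1))⁻¹ * ((Pmodel L M V (k + 1))ᴴ * JpcT L M k - JpcT L M k * (Pmodel L M V k)ᴴ)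
        * (calDalev L M a ha k)⁻¹‖ ≤ _
    rw [calDalev_inv, calDalev_inv]
    have h := opNorm_adjoint_consistency_le (lev L k) L M a ha hd (one_le_lev' L k) (one_le_lev' L (k + 1)) hV.nonneg.1
      hV.nonneg.2 (div_nonneg hV.nonneg.2 hlev.le) (hV.bound k) (fun μ i => hV.lipschitz k μ μ i) (hV.consistent k)
    refine h.trans (le_of_eq ?_)
    rw [C2adj, cast_lev', inv_pow]
    have hLk : (0 : ℝ) < (L : ℝ) ^ k := pow_pos hLpos k
    field_simp

/-- **`PerturbationLaws` FOR THE SELF-ADJOINT FIRST-ORDER COUPLING `F + Fᴴ`**, `F_k = Σ_μ diag(V^{(k)}_μ)∇^{(k)}_μ`: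
`κ = 2d(α + β)Cst`, `e₂ k = (C₂ + C₂ᴴ)·L^{−k}`. [folklore] -/
theorem perturbationLaws_selfAdjointFirstOrder (hd : 1 ≤ d) {V : (k : ℕ) → Fin d → (idx L M k → ℂ)} {α β : ℝ}
    (hV : LipschitzBackground L M V α β) :
    PerturbationLaws (calDalev L M a ha) (fun k => Pmodel L M V k + (Pmodel L M V k)ᴴ) (JpcT L M) (2 * (d * (α + β) * Cst d a))
      (fun k => (C2model d L a α β + C2adj d L a α β) * ((L : ℝ)⁻¹) ^ k) := by
  have h := perturbationLaws_add (perturbationLaws_firstOrder L M a ha hd hV) (perturbationLaws_firstOrderAdjoint L M a ha hd hV)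
  refine perturbationLaws_mono h (le_of_eq (two_mul _).symm) fun k => le_of_eq ?_
  ring

/-- **η-RATE FOR THE SELF-ADJOINT FIRST-ORDER COUPLING** (`L ≥ 2`, `d ≥ 1`): the King-averaged unit-lattice covariances of
`(Δ_a^{(k)} + t·(F_k + F_kᴴ))⁻¹` converge with rate `L^{−k}` for `‖t‖·2d(α + β)Cst < 1`. [cite: King1986, Lemma 4.5 p.674;
Balaban1985BackgroundPropagators, (3.3) p.390 (shape)] [folklore] -/
theorem towerLimitRate_selfAdjointFirstOrder (hL : 2 ≤ L) (hd : 1 ≤ d) {V : (k : ℕ) → Fin d → (idx L M k → ℂ)} {α β : ℝ}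
    (hV : LipschitzBackground L M V α β) {t : ℂ} (ht : ‖t‖ * (2 * (d * (α + β) * Cst d a)) < 1) :
    TowerLimitRate (Qlev L M) ((L : ℝ) ^ d) (fun k => (calDalev L M a ha k + t • (Pmodel L M V k + (Pmodel L M V k)ᴴ))⁻¹)
      (Cpert (2 * (d * (α + β) * Cst d a)) (2 * d * Cst d a) (CJ d a) (C2model d L a α β + C2adj d L a α β) 0 t)
      ((L : ℝ)⁻¹) :=
  towerLimitRate_perturbed_king L M a ha hL (perturbationLaws_selfAdjointFirstOrder L M a ha hd hV) ht

end Tower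

end Summit.QuantumFields.BalabanUV.T4Continuum.FirstOrderAdjointModel

end
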